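import Mathlib
import Literature.Geometry.Lorentzian.GiorgiKlainermanSzeftel2022.GRWTransformationAlgebra

/-!
# Giorgi–Klainerman–Szeftel, *Wave equations estimates and the nonlinear stability of slowly rotating Kerr black holes* — App. D.9 ledger: the wave equation for `P` (proof of Lemma 5.5.1)

Sources, read side by side (the loci of both are given in every docstring):

* `[J]`  E. Giorgi, S. Klainerman, J. Szeftel, *Wave equations estimates and the nonlinear
  stability of slowly rotating Kerr black holes*, Pure Appl. Math. Q. **20** (2024), no. 7
  (doi:10.4310/pamq.241128023033) — Lemma 5.5.1 with (5.5.1), (5.5.2) (file p0205 L5–72),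
  Remark 5.5.2 (p0205 L74–80) and Appendix D.9 "Proof of Lemma 5.5.1" (p0927 L62 – p0931 L70); the
  quoted inputs Proposition 2.4.15 (Bianchi identities in complex notation, p0118 L33–100; the rows
  `ᶜ∇₃B − ᶜ𝒟P̄` L46–48 and `ᶜ∇₄P − ½ᶜ𝒟·B̄` L49–55), Proposition 2.4.14 (null structure equations,
  p0117 L43 – p0118 L31; the rows `ᶜ∇₃tr X` p0117 L61–66, `ᶜ∇₃H̲ − ᶜ∇₄Ξ̲` p0118 L5–9 and
  `½conj(ᶜ𝒟)·X̲̂` p0118 L24–27), Definition 2.4.8 (`tr X = tr χ − iªtr χ`, `tr X̲ = tr χ̲ − iªtr χ̲`,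
  p0113 L29–48), Lemma 2.2.17 (conformal derivatives, p0105 L7–10), Lemma 2.2.8 (2.2.15) (the frame
  commutator `[∇₄, ∇₃]f`, p0096 L25–40), Lemma 4.7.4 (decomposition of the wave operator in null
  frames, p0180 L24–39) and the commutator `[ᶜ∇₃, conj(ᶜ𝒟)·]F` exactly as App. D.9 quotes it
  ("see Lemma 4.2.2", p0928 L68–74; Lemma 4.2.2 itself, p0162 L8 – p0163 L86, displays for
  `F ∈ 𝔰₁(ℂ)` only the error form (4.2.16), p0163 L77–86).  **Locator convention (as in the siblings
  `TeukolskyAbarWaveLedger`, `TeukolskyStarobinskiPrelimLedger`): `[J]` pages are the FILE pages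
  `p0NNN` of the materialised journal PDF (= printed folio + 1), `Lnn` the line of the text layer of
  that file.**  The text layer drops under-bars, over-bars, hats and the placement of the `⁽ᶜ⁾`
  superscripts; every barred symbol below was read on the `[v1]` TeX source, the `[J]` locus is given
  for position, and the two texts were collated display by display (they agree throughout D.9).
* `[v1]` the same authors, arXiv:2205.14808 (v1), TeX source `FinalKerrarxivversion.tex`, lines
  `l.N`: Lemma `LEMMA:WAVEEQP` l.9335–9360 (`eq:WaveEq-forP` = (5.5.1) l.9339, `eq:err-square-P-precise`
  = (5.5.2) l.9347), Remark `rem:error-terms-square-P` l.9363–9369, App. `proof-wave-P` = `[J]` D.9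
  l.37551–37686; the quoted inputs Proposition `prop:bianchi:complex-conf` l.5255–5270 (rows l.5262,
  l.5263), Proposition `prop-nullstr:complex-conf` l.5226–5252 (rows l.5234, l.5245, l.5251),
  Definition `def:complexRicciandcurvaturecoefficients` l.5041–5055, Lemma
  `lemma:definition-conformal-derivatives` l.4559–4568, Lemma `lemma:comm`
  (`eq:comm-nab3-nab4-naba-f-general`, third line) l.4220–4235, Lemma `lemma:expression-wave-operator`
  l.8128–8138, Lemma `COMMUTATOR-NAB-C-3-DD-C-HOT` l.7369ff.  Lemma 5.5.1 is used in `[J]` Chapter 14,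
  (14.2.1) = `[v1]` `eq:P-WaveEq-M8` l.26289–26295 (Step 0 of the proof of the Morawetz–energy
  estimate for `P`), through the schematic form of Remark 5.5.2.

## What is transcribed

App. D.9 differentiates the Bianchi identity `ᶜ∇₄P − ½ᶜ𝒟·B̄ = −(3/2)tr X P + H̲·B̄ − Ξ̄·B̲ − ¼X̲̂·Ā`
by `ᶜ∇₃`, substitutes the (conjugated) Bianchi identity
`ᶜ∇₃B̄ − conj(ᶜ𝒟)P = −conj(tr X̲)B̄ + 3PH̄ + B̲·conj X̂ + ½Ā·Ξ̲` and the commutator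
`[ᶜ∇₃, ᶜ𝒟·]B̄ = −½tr X̲ ᶜ𝒟·B̄ + H·ᶜ∇₃B̄ − B̲̄·B + Ξ̲·∇₄B̄ − conj(X̲̂)·ᶜ𝒟B̄ − H̄·conj(X̲̂)·B`
("which for `B` and `s = 1`"), rewrites the left-hand side ("Observe that the LHS of the above
becomes", p0929 L50–65) and the right-hand side ("while the RHS, using … gives the following",
p0929 L67 – p0930 L61, with the error term `Err` of p0930 L63–105), puts the two together with the
null structure equation for `ᶜ∇₃tr X` (p0930 L107–140), and finally converts, for `P` of conformal
type `0`, the null-frame decomposition of `□_g` (Lemma 4.7.4 with the frame commutator (2.2.15), the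
display `½𝒟·conj(𝒟)P = ΔP − (i/2)(ªtr χ e₃P + ªtr χ̲ e₄P)` and `H̄·𝒟P + H·conj(𝒟)P = 4η·∇P`,
p0931 L5–52) into `□_g P = −ᶜ∇₃ᶜ∇₄P + ½ᶜ𝒟·conj(ᶜ𝒟)P − ½tr X̲ ᶜ∇₄P − ½tr X ᶜ∇₃P + ½H̄·ᶜ𝒟P
+ ½H·conj(ᶜ𝒟)P`, "and then obtains from the above computations" Lemma 5.5.1:
`□_g P = tr X ᶜ∇₃P + conj(tr X̲) ᶜ∇₄P − H̄·ᶜ𝒟P − H̲·conj(ᶜ𝒟)P + (3/2)[conj(tr X̲) tr X + 2P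
− 2H̲·H̄]P + Err[□_g P]` with the printed `Err[□_g P] = Err − (3/2)(Ξ̲·Ξ̄ − ½X̲̂·conj X̂)P` (p0931
L54–68 = (5.5.1), (5.5.2)).

## How it is typed (the scalar–module shadow of the siblings; nothing tensorial is derived)

* Scalars: an abstract field `K` (`CharZero` where printed fractions are cleared); `p = P`, `x = tr X`, `xb = tr X̲`, `xbc = conj(tr X̲)`,
  `jxb = iℑ(tr X̲)`, `jx = iℑ(tr X)` (related to `xb`, `xbc` only through the hypothesis
  `xb − xbc = 2jxb`, i.e. `z − z̄ = 2iℑz`, where the text uses it), `c4P = ᶜ∇₄P`; `ᶜ∇₃` acts on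
  scalars through `D3 : Derivation ℤ K K` (so `ᶜ∇₃P = D3 p`, `ᶜ∇₃tr X = D3 x`, `ᶜ∇₃ᶜ∇₄P = D3 c4P`,
  `ᶜ∇₃(Ξ̄·B̲) = D3 XicBb`, `ᶜ∇₃(X̲̂·Ā) = D3 XbhAc`; the Leibniz rule is signature-blind, which is all
  the displays use).  The products of two tensors that the text never opens are opaque scalars:
  `XicBb = Ξ̄·B̲`, `XbhAc = X̲̂·Ā`, `BbcB = B̲̄·B`, `XibN4Bc = Ξ̲·∇₄B̄`, `XbhcDBc = conj(X̲̂)·ᶜ𝒟B̄`,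
  `HcXbhcB = H̄·conj(X̲̂)·B`, `XibXic = Ξ̲·Ξ̄`, `XbhXhc = X̲̂·conj X̂`; `Err` is the scalar DEFINED by
  the display p0930 L63–105 (hypothesis `hErr`, verbatim), `boxP = □_g P`.
* One-forms: a `K`-module `M₁` with `Bc = B̄`, `Hu = H̲`, `H`, `Hc = H̄`, `DP = ᶜ𝒟P`, `DbP = conj(ᶜ𝒟)P`,
  `Dxbc = ᶜ𝒟conj(tr X̲)`, `Xib = Ξ̲`, `Bb = B̲`, `N4Xib = ᶜ∇₄Ξ̲`, and the opaque one-forms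
  `BbXhc = B̲·conj X̂`, `AcXib = Ā·Ξ̲`, `DbXbh = conj(ᶜ𝒟)·X̲̂`, `XbhHd = X̲̂·(conj H̲ − H̄)`.  `ᶜ∇₃` on
  `M₁` is the sibling's `CovD D3 M₁` BY NAME (`N3`; additive with the scalar Leibniz rule); the
  product `F·G` of complex one-forms is `dot : M₁ →ₗ[K] M₁ →ₗ[K] K` (bilinear, no conjugation, as in
  `[J]` §2.4); `ᶜ𝒟·` on one-forms is an additive map `div : M₁ →+ K` whose two product-rule instances
  the text expands (`ᶜ𝒟·(conj(tr X̲)B̄)` at p0929 L5–10 and `½ᶜ𝒟·(3PH̄)` at p0929 L50–65) enter as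
  the hypotheses `hdivxB`, `hdivpH`, exactly as `ᶜ∇₃(H̲·B̄) = ᶜ∇₃H̲·B̄ + H̲·ᶜ∇₃B̄` (p0927 L80–101)
  enters as `hd3HB`; the commutator `[ᶜ∇₃, ᶜ𝒟·]B̄` is the scalar `comm` with its definition `hcomm :
  comm = D3 (div Bc) − div (N3.op Bc)`.  Complex conjugation is not modelled: the conjugated Bianchi
  identity (p0928 L2–8) and the `s = 1` instance of the quoted commutator are typed in the conjugated
  variables in which D.9 displays them (the latter with `s` free, `hcommF`, and `hs : s = 1`).
* §8 (the conversion to `e₃, e₄, ∇`): real one-forms `eta = η`, `etab = η̲`, `gradP = ∇P` in the same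
  `M₁`; scalars `trch, atrch, trchb, atrchb, om, omb` (`tr χ, ªtr χ, tr χ̲, ªtr χ̲, ω, ω̲`), `e3P, e4P`,
  `e3e4P = e₃(e₄(P))`, `e4e3P = e₄(e₃(P))`, `LapP = ΔP`, and `i`.  For `P` of signature `0` the conformal
  and plain horizontal derivatives coincide (Lemma 2.2.17 (3), Definition 2.4.13), so `DP`, `DbP`,
  `div DbP` serve for `𝒟P`, `conj(𝒟)P`, `𝒟·conj(𝒟)P` as well; the dictionary entries that change a
  symbol are hypotheses: `ᶜ∇₃P = e₃P`, `ᶜ∇₄P = e₄P` (signature `0`), `ᶜ∇₃ᶜ∇₄P = e₃(e₄P) − 2ω̲e₄P`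
  (Lemma 2.2.17 (1) at signature `1`), `tr X = tr χ − iªtr χ`, `tr X̲ = tr χ̲ − iªtr χ̲` (Definition
  2.4.8).  The two displays "Also, we have `½𝒟·conj(𝒟)P = … = ΔP − (i/2)(ªtr χ e₃P + ªtr χ̲ e₄P)`"
  and "`H̄·𝒟P + H·conj(𝒟)P = 4η·∇P`" (p0931 L13–37) enter as hypotheses (`hDDb`, `hHD`): their
  internal frame computation is not re-derived.
* Every quoted equation enters as a HYPOTHESIS exactly in its displayed form; every display the text
  introduces with "we obtain / we infer / we deduce / hence / becomes / gives / by putting the two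
  together / we then obtain" is a THEOREM, and `D9_lemma551_end_to_end` re-derives the conclusion from
  the primitive quoted hypotheses alone.  What the kernel certifies is exactly the displayed coefficient
  bookkeeping.

## Certified (0 sorry, 0 def; every theorem closes by `subst`/`rw`/`simp only`/`linear_combination`)

* §1 `D9_differentiate`: "We differentiate w.r.t. `ᶜ∇₃` and obtain" (p0927 L80–101).
* §2 `D9_deduce`, `D9_hence1`: "We deduce" and "and hence" (p0928 L9–66).
* §3 `D9_commutator_B`: the `s = 1` instance of the quoted commutator (p0928 L68–80).
* §4 `D9_hence2`: "Hence," (p0929 L5–48).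
* §5 `D9_LHS`: "Observe that the LHS of the above becomes" (p0929 L50–65).
* §6 `D9_using` (the four "using" identities, p0929 L67–101, from Propositions 2.4.14/2.4.15),
  `D9_RHS_regroup`, `D9_RHS_subst`, `D9_RHS_cancel`: the three equalities of "gives the following"
  (p0930 L5–61) with `Err` as printed (p0930 L63–105); the `B̄`-terms cancel by `tr X̲ − conj(tr X̲) =
  2iℑ(tr X̲)`.
* §7 `D9_together`: "By putting the two together we obtain" (p0930 L107–131) using the `ᶜ∇₃tr X` null
  structure equation (p0930 L133–140).
* §8 `D9_box_frame`: "From Lemma 4.7.4, we deduce" (p0931 L5–12) from Lemma 4.7.4 and (2.2.15);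
  `D9_box_type0`: "We therefore deduce for `P` of conformal type 0" (p0931 L38–52).
* §9 `D9_lemma551`: "We then obtain from the above computations" — the main terms of (5.5.1) exactly as
  printed, with the remainder the kernel finds (see Print data); `D9_err_datum`: the same with the
  printed `Err[□_g P]` named; `D9_lemma551_end_to_end`: the conclusion in ONE theorem from the primitive
  quoted hypotheses.

## Print data found by the kernel / by collation (offered to the cell's census, not rulings)

(PD-sign) Every intermediate display of D.9 (p0927 L80 – p0931 L52) is reproduced by the kernel with
the printed coefficients, and so are the principal terms of (5.5.1) (`tr X ᶜ∇₃P + conj(tr X̲)ᶜ∇₄P −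
H̄·ᶜ𝒟P − H̲·conj(ᶜ𝒟)P + (3/2)[conj(tr X̲)tr X + 2P − 2H̲·H̄]P`).  The remainder, however, comes out
as `−Err + (3/2)(Ξ̲·Ξ̄ − ½X̲̂·conj X̂)P`, the NEGATIVE of the printed `Err[□_g P] = Err − (3/2)(Ξ̲·Ξ̄
− ½X̲̂·conj X̂)P` (p0931 L60–68, = (5.5.2) p0205 L14–72, `[v1]` l.9347–9356 and l.37680–37684): the
last step substitutes `ᶜ∇₃ᶜ∇₄P` from "putting the two together" into `□_g P = −ᶜ∇₃ᶜ∇₄P + …`, and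
the minus sign is carried onto the principal terms but not onto `Err − (3/2)(…)P` (`D9_err_datum`:
with `Err[□_g P]` as printed the kernel's identity reads `□_g P = ⟨principal terms⟩ − Err[□_g P]`).
`[J]` = `[v1]` here.  Reading note, not a ruling: downstream the error term is only used through the
schematic form of Remark 5.5.2 / (14.2.1) (`r⁻¹𝔡^{≤1}(Γ_g·B̲) + … − A̲·Ā`), whose displayed signs
and constants are schematic; the class of the datum is for the census lead.

## Not claimed

No tensorial statement, Bianchi identity, null structure equation, commutation formula, Leibniz
formula or wave-operator decomposition is derived; complex conjugation, the signatures of Lemma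
2.2.17, the Hodge-dual algebra behind the two "Also, we have" displays and the frame computation of
`½𝒟·conj(𝒟)P` are quoted, not proved; the general-`s` commutator is typed as D.9 quotes it (it is not
a displayed statement of Lemma 4.2.2 for `F ∈ 𝔰₁(ℂ)`, which prints the error form (4.2.16) only);
the decay classes `Γ_g, Γ_b`, the symbols `r⁻ᵏ𝔡^{≤j}` and Remark 5.5.2 are outside the model and are
mentioned in docstrings only as the text's words.  Nothing here is a hypothesis-fact of `[J]`; no
`def … : Prop`.  This module is a typed reading aid for the cell's census of `[J]` ch. 5 / App. D
(the leaf "wave equation for `P`" of the Chapter 14 estimates), not progress on any summit.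
-/

namespace Literature.Geometry.Lorentzian.GiorgiKlainermanSzeftel2022.PWaveEquationLedger

open Literature.Geometry.Lorentzian.GiorgiKlainermanSzeftel2022.GRWTransformationAlgebra

variable {K : Type*} [Field K]

section AppD9

variable {M₁ : Type*} [AddCommGroup M₁] [Module K M₁]

/-! ## §1 "We differentiate w.r.t. `ᶜ∇₃` and obtain" -/

/-- From the Bianchi identity "`ᶜ∇₄P − ½ᶜ𝒟·B̄ = −(3/2)tr X P + H̲·B̄ − Ξ̄·B̲ − ¼X̲̂·Ā`" (`hB1`,
Proposition 2.4.15), the definition of the commutator `[ᶜ∇₃, ᶜ𝒟·]B̄ = ᶜ∇₃(ᶜ𝒟·B̄) − ᶜ𝒟·ᶜ∇₃B̄`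
(`hcomm`) and the Leibniz rule `ᶜ∇₃(H̲·B̄) = ᶜ∇₃H̲·B̄ + H̲·ᶜ∇₃B̄` (`hd3HB`):
"`ᶜ∇₃ᶜ∇₄P − ½ᶜ𝒟·ᶜ∇₃B̄ − ½[ᶜ∇₃, ᶜ𝒟·]B̄ = −(3/2)Pᶜ∇₃tr X − (3/2)tr X ᶜ∇₃P + ᶜ∇₃H̲·B̄ + H̲·ᶜ∇₃B̄
− ᶜ∇₃(Ξ̄·B̲) − ¼ᶜ∇₃(X̲̂·Ā)`".
[cite: GiorgiKlainermanSzeftel2024, p0927 L66–101, Proposition 2.4.15 p0118 L49–55; GiorgiKlainermanSzeftel2022, l.37555–37564, l.5263] -/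
theorem D9_differentiate [CharZero K] {D3 : Derivation ℤ K K} (N3 : CovD D3 M₁)
    (dot : M₁ →ₗ[K] M₁ →ₗ[K] K) (div : M₁ →+ K) (p x c4P comm XicBb XbhAc : K) (Bc Hu : M₁)
    (hB1 : c4P - 1 / 2 * div Bc = -(3 / 2) * x * p + dot Hu Bc - XicBb - 1 / 4 * XbhAc)
    (hcomm : comm = D3 (div Bc) - div (N3.op Bc))
    (hd3HB : D3 (dot Hu Bc) = dot (N3.op Hu) Bc + dot Hu (N3.op Bc)) :
    D3 c4P - 1 / 2 * div (N3.op Bc) - 1 / 2 * comm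
      = -(3 / 2) * p * D3 x - 3 / 2 * x * D3 p + dot (N3.op Hu) Bc + dot Hu (N3.op Bc)
        - D3 XicBb - 1 / 4 * D3 XbhAc := by
  obtain ⟨h2, -, h4, h6, -⟩ := D_num D3
  have h' : 4 * c4P - 2 * div Bc = -(6 * (x * p)) + 4 * dot Hu Bc - 4 * XicBb - XbhAc := by
    linear_combination 4 * hB1
  have hD := congrArg D3 h'
  simp only [map_sub, map_add, map_neg, D3.leibniz, smul_eq_mul, h2, h4, h6, mul_zero,
    add_zero] at hD
  linear_combination (1 / 4 : K) * hD - (1 / 2 : K) * hcomm + hd3HB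

/-! ## §2 "We deduce" and "and hence" -/

/-- Substituting the conjugated Bianchi identity "`ᶜ∇₃B̄ − conj(ᶜ𝒟)P = −conj(tr X̲)B̄ + 3PH̄ +
B̲·conj X̂ + ½Ā·Ξ̲`" (`hB2c`, the complex conjugate of the row `ᶜ∇₃B − ᶜ𝒟P̄` of Proposition 2.4.15,
as displayed) into the display of §1 (`hdiff`): "We deduce
`ᶜ∇₃ᶜ∇₄P − ½ᶜ𝒟·(conj(ᶜ𝒟)P − conj(tr X̲)B̄ + 3PH̄) − ½[ᶜ∇₃, ᶜ𝒟·]B̄ = −(3/2)Pᶜ∇₃tr X − (3/2)tr X ᶜ∇₃P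
+ ᶜ∇₃H̲·B̄ + H̲·(conj(ᶜ𝒟)P − conj(tr X̲)B̄ + 3PH̄) − ᶜ∇₃(Ξ̄·B̲) − ¼ᶜ∇₃(X̲̂·Ā) + ½ᶜ𝒟·(B̲·conj X̂
+ ½Ā·Ξ̲) + H̲·(B̲·conj X̂ + ½Ā·Ξ̲)`".
[cite: GiorgiKlainermanSzeftel2024, p0927 L103 – p0928 L37, Proposition 2.4.15 p0118 L46–48; GiorgiKlainermanSzeftel2022, l.37565–37580, l.5262] -/
theorem D9_deduce {D3 : Derivation ℤ K K} (N3 : CovD D3 M₁) (dot : M₁ →ₗ[K] M₁ →ₗ[K] K)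
    (div : M₁ →+ K) (p x xbc c4P comm XicBb XbhAc : K) (Bc Hu Hc DbP BbXhc AcXib : M₁)
    (hdiff : D3 c4P - 1 / 2 * div (N3.op Bc) - 1 / 2 * comm
      = -(3 / 2) * p * D3 x - 3 / 2 * x * D3 p + dot (N3.op Hu) Bc + dot Hu (N3.op Bc)
        - D3 XicBb - 1 / 4 * D3 XbhAc)
    (hB2c : N3.op Bc - DbP = -(xbc • Bc) + (3 * p) • Hc + BbXhc + (1 / 2 : K) • AcXib) :
    D3 c4P - 1 / 2 * div (DbP - xbc • Bc + (3 * p) • Hc) - 1 / 2 * comm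
      = -(3 / 2) * p * D3 x - 3 / 2 * x * D3 p + dot (N3.op Hu) Bc
        + dot Hu (DbP - xbc • Bc + (3 * p) • Hc) - D3 XicBb - 1 / 4 * D3 XbhAc
        + 1 / 2 * div (BbXhc + (1 / 2 : K) • AcXib) + dot Hu (BbXhc + (1 / 2 : K) • AcXib) := by
  have e_div := congrArg (fun v => div v) hB2c
  have e_dot := congrArg (fun v => dot Hu v) hB2c
  simp only [map_add, map_sub, map_neg, map_smul, smul_eq_mul] at e_div e_dot ⊢
  linear_combination hdiff + (1 / 2 : K) * e_div + e_dot

/-- "and hence `ᶜ∇₃ᶜ∇₄P + (3/2)Pᶜ∇₃tr X + (3/2)tr X ᶜ∇₃P − ½ᶜ𝒟·(conj(ᶜ𝒟)P + 3PH̄)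
− H̲·(conj(ᶜ𝒟)P + 3PH̄) = −½ᶜ𝒟·(conj(tr X̲)B̄) + ½[ᶜ∇₃, ᶜ𝒟·]B̄ + ᶜ∇₃H̲·B̄ − conj(tr X̲)H̲·B̄
− ᶜ∇₃(Ξ̄·B̲) − ¼ᶜ∇₃(X̲̂·Ā) + ½ᶜ𝒟·(B̲·conj X̂ + ½Ā·Ξ̲) + H̲·(B̲·conj X̂ + ½Ā·Ξ̲)`" (from `hded`, the
display of `D9_deduce`, by the additivity of `ᶜ𝒟·` and the bilinearity of `·`).
[cite: GiorgiKlainermanSzeftel2024, p0928 L38–66; GiorgiKlainermanSzeftel2022, l.37581–37589] -/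
theorem D9_hence1 {D3 : Derivation ℤ K K} (N3 : CovD D3 M₁) (dot : M₁ →ₗ[K] M₁ →ₗ[K] K)
    (div : M₁ →+ K) (p x xbc c4P comm XicBb XbhAc : K) (Bc Hu Hc DbP BbXhc AcXib : M₁)
    (hded : D3 c4P - 1 / 2 * div (DbP - xbc • Bc + (3 * p) • Hc) - 1 / 2 * comm
      = -(3 / 2) * p * D3 x - 3 / 2 * x * D3 p + dot (N3.op Hu) Bc
        + dot Hu (DbP - xbc • Bc + (3 * p) • Hc) - D3 XicBb - 1 / 4 * D3 XbhAc
        + 1 / 2 * div (BbXhc + (1 / 2 : K) • AcXib) + dot Hu (BbXhc + (1 / 2 : K) • AcXib)) :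
    D3 c4P + 3 / 2 * p * D3 x + 3 / 2 * x * D3 p - 1 / 2 * div (DbP + (3 * p) • Hc)
        - dot Hu (DbP + (3 * p) • Hc)
      = -(1 / 2 * div (xbc • Bc)) + 1 / 2 * comm + dot (N3.op Hu) Bc - xbc * dot Hu Bc
        - D3 XicBb - 1 / 4 * D3 XbhAc + 1 / 2 * div (BbXhc + (1 / 2 : K) • AcXib)
        + dot Hu (BbXhc + (1 / 2 : K) • AcXib) := by
  simp only [map_add, map_sub, map_smul, smul_eq_mul] at hded ⊢
  linear_combination hded

/-! ## §3 The commutator "for `B` and `s = 1`" -/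

/-- D.9 quotes ("see Lemma 4.2.2") "`[ᶜ∇₃, conj(ᶜ𝒟)·]F = −½conj(tr X̲)(conj(ᶜ𝒟)·F + (s − 1)H̄·F)
+ H̄·ᶜ∇₃F − B̲·F̄ + Ξ̲̄·∇₄F − X̲̂·conj(ᶜ𝒟)F − H·X̲̂·F̄`", "which for `B` and `s = 1`" gives (after
complex conjugation) "`[ᶜ∇₃, ᶜ𝒟·]B̄ = −½tr X̲ ᶜ𝒟·B̄ + H·ᶜ∇₃B̄ − B̲̄·B + Ξ̲·∇₄B̄ − conj(X̲̂)·ᶜ𝒟B̄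
− H̄·conj(X̲̂)·B`".  Typed: the conjugate of the quoted formula at `F = B` with `s` free (`hcommF`) and
`s = 1` (`hs`); the kernel's content is only `(s − 1)H·B̄ = 0`.  (Lemma 4.2.2 displays this
commutator for `F ∈ 𝔰₁(ℂ)` in error form only, (4.2.16).)
[cite: GiorgiKlainermanSzeftel2024, p0928 L68–80, (4.2.16) p0163 L77–86; GiorgiKlainermanSzeftel2022, l.37590–37599, l.7369] -/
theorem D9_commutator_B {D3 : Derivation ℤ K K} (N3 : CovD D3 M₁) (dot : M₁ →ₗ[K] M₁ →ₗ[K] K)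
    (div : M₁ →+ K) (s xb comm BbcB XibN4Bc XbhcDBc HcXbhcB : K) (Bc H : M₁)
    (hcommF : comm = -(1 / 2) * xb * (div Bc + (s - 1) * dot H Bc) + dot H (N3.op Bc)
      - BbcB + XibN4Bc - XbhcDBc - HcXbhcB)
    (hs : s = 1) :
    comm = -(1 / 2) * xb * div Bc + dot H (N3.op Bc) - BbcB + XibN4Bc - XbhcDBc - HcXbhcB := by
  subst hs
  linear_combination hcommF

/-! ## §4 "Hence," -/

/-- Inserting the commutator (`hcB`, §3) and the product rule `ᶜ𝒟·(conj(tr X̲)B̄) = conj(tr X̲)ᶜ𝒟·B̄ +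
ᶜ𝒟conj(tr X̲)·B̄` (`hdivxB`) into the display of `D9_hence1` (`hh1`): "Hence,
`ᶜ∇₃ᶜ∇₄P + (3/2)Pᶜ∇₃tr X + (3/2)tr X ᶜ∇₃P − ½ᶜ𝒟·(conj(ᶜ𝒟)P + 3PH̄) − H̲·(conj(ᶜ𝒟)P + 3PH̄)
= −½conj(tr X̲)ᶜ𝒟·B̄ − ½ᶜ𝒟conj(tr X̲)·B̄ + ½(−½tr X̲ ᶜ𝒟·B̄ + H·ᶜ∇₃B̄) + ᶜ∇₃H̲·B̄ − conj(tr X̲)H̲·B̄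
− ᶜ∇₃(Ξ̄·B̲) − ¼ᶜ∇₃(X̲̂·Ā) + ½ᶜ𝒟·(B̲·conj X̂ + ½Ā·Ξ̲) + H̲·(B̲·conj X̂ + ½Ā·Ξ̲)
+ ½(−B̲̄·B + Ξ̲·∇₄B̄ − conj(X̲̂)·ᶜ𝒟B̄ − H̄·conj(X̲̂)·B)`".
[cite: GiorgiKlainermanSzeftel2024, p0929 L5–48; GiorgiKlainermanSzeftel2022, l.37600–37609] -/
theorem D9_hence2 {D3 : Derivation ℤ K K} (N3 : CovD D3 M₁) (dot : M₁ →ₗ[K] M₁ →ₗ[K] K)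
    (div : M₁ →+ K)
    (p x xb xbc c4P comm XicBb XbhAc BbcB XibN4Bc XbhcDBc HcXbhcB : K)
    (Bc Hu H Hc DbP Dxbc BbXhc AcXib : M₁)
    (hh1 : D3 c4P + 3 / 2 * p * D3 x + 3 / 2 * x * D3 p - 1 / 2 * div (DbP + (3 * p) • Hc)
        - dot Hu (DbP + (3 * p) • Hc)
      = -(1 / 2 * div (xbc • Bc)) + 1 / 2 * comm + dot (N3.op Hu) Bc - xbc * dot Hu Bc
        - D3 XicBb - 1 / 4 * D3 XbhAc + 1 / 2 * div (BbXhc + (1 / 2 : K) • AcXib)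
        + dot Hu (BbXhc + (1 / 2 : K) • AcXib))
    (hcB : comm = -(1 / 2) * xb * div Bc + dot H (N3.op Bc) - BbcB + XibN4Bc - XbhcDBc - HcXbhcB)
    (hdivxB : div (xbc • Bc) = xbc * div Bc + dot Dxbc Bc) :
    D3 c4P + 3 / 2 * p * D3 x + 3 / 2 * x * D3 p - 1 / 2 * div (DbP + (3 * p) • Hc)
        - dot Hu (DbP + (3 * p) • Hc)
      = -(1 / 2) * xbc * div Bc - 1 / 2 * dot Dxbc Bc
        + 1 / 2 * (-(1 / 2) * xb * div Bc + dot H (N3.op Bc))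
        + dot (N3.op Hu) Bc - xbc * dot Hu Bc - D3 XicBb - 1 / 4 * D3 XbhAc
        + 1 / 2 * div (BbXhc + (1 / 2 : K) • AcXib) + dot Hu (BbXhc + (1 / 2 : K) • AcXib)
        + 1 / 2 * (-BbcB + XibN4Bc - XbhcDBc - HcXbhcB) := by
  linear_combination hh1 + (1 / 2 : K) * hcB - (1 / 2 : K) * hdivxB

/-! ## §5 "Observe that the LHS of the above becomes" -/

/-- With `½ᶜ𝒟·(3PH̄) = (3/2)Pᶜ𝒟·H̄ + (3/2)H̄·ᶜ𝒟P` (the product rule and the symmetry of `·`, `hdivpH`)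
and the bilinearity of `·`: "`LHS = ᶜ∇₃ᶜ∇₄P + (3/2)tr X ᶜ∇₃P − ½ᶜ𝒟·conj(ᶜ𝒟)P − (3/2)H̄·ᶜ𝒟P
− H̲·conj(ᶜ𝒟)P + (3/2)[−ᶜ𝒟·H̄ + ᶜ∇₃tr X − 2H̲·H̄]P`".
[cite: GiorgiKlainermanSzeftel2024, p0929 L50–65; GiorgiKlainermanSzeftel2022, l.37610–37614] -/
theorem D9_LHS [CharZero K] (D3 : Derivation ℤ K K) (dot : M₁ →ₗ[K] M₁ →ₗ[K] K) (div : M₁ →+ K)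
    (p x c4P : K) (Hu Hc DP DbP : M₁)
    (hdivpH : div ((3 * p) • Hc) = 3 * p * div Hc + 3 * dot Hc DP) :
    D3 c4P + 3 / 2 * p * D3 x + 3 / 2 * x * D3 p - 1 / 2 * div (DbP + (3 * p) • Hc)
        - dot Hu (DbP + (3 * p) • Hc)
      = D3 c4P + 3 / 2 * x * D3 p - 1 / 2 * div DbP - 3 / 2 * dot Hc DP - dot Hu DbP
        + 3 / 2 * (-div Hc + D3 x - 2 * dot Hu Hc) * p := by
  simp only [map_add, map_smul, smul_eq_mul]
  linear_combination (-(1 / 2) : K) * hdivpH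

/-! ## §6 "while the RHS, using …, gives the following" -/

/-- The four identities "using": "`½ᶜ𝒟·B̄ = ᶜ∇₄P + (3/2)tr X P − H̲·B̄ + Ξ̄·B̲ + ¼X̲̂·Ā`" and
"`ᶜ∇₃B̄ = conj(ᶜ𝒟)P + 3PH̄ − conj(tr X̲)B̄ + B̲·conj X̂ + ½Ā·Ξ̲`" (the two Bianchi identities `hB1`,
`hB2c` rearranged), "`−½ᶜ𝒟conj(tr X̲) = −iℑ(tr X̲)H̲ − ½conj(ᶜ𝒟)·X̲̂ − iℑ(tr X)Ξ̲ + B̲`" (from the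
null structure equation "`½conj(ᶜ𝒟)·X̲̂ = ½ᶜ𝒟conj(tr X̲) − iℑ(tr X̲)H̲ − iℑ(tr X)Ξ̲ + B̲`", `hN6`) and
"`ᶜ∇₃H̲ = −½conj(tr X̲)(H̲ − H) + ᶜ∇₄Ξ̲ − ½X̲̂·(conj H̲ − H̄) + B̲`" (from "`ᶜ∇₃H̲ − ᶜ∇₄Ξ̲ =
−½conj(tr X̲)(H̲ − H) − ½X̲̂·(conj H̲ − H̄) + B̲`", `hN5`).
[cite: GiorgiKlainermanSzeftel2024, p0929 L67–101, Proposition 2.4.14 p0118 L5–9 and L24–27, Proposition 2.4.15 p0118 L46–55; GiorgiKlainermanSzeftel2022, l.37615–37621, l.5245, l.5251, l.5262–5263] -/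
theorem D9_using {D3 : Derivation ℤ K K} (N3 : CovD D3 M₁) (dot : M₁ →ₗ[K] M₁ →ₗ[K] K)
    (div : M₁ →+ K) (p x xbc c4P XicBb XbhAc jxb jx : K)
    (Bc Hu H Hc DbP Dxbc BbXhc AcXib DbXbh Xib Bb N4Xib XbhHd : M₁)
    (hB1 : c4P - 1 / 2 * div Bc = -(3 / 2) * x * p + dot Hu Bc - XicBb - 1 / 4 * XbhAc)
    (hB2c : N3.op Bc - DbP = -(xbc • Bc) + (3 * p) • Hc + BbXhc + (1 / 2 : K) • AcXib)
    (hN6 : (1 / 2 : K) • DbXbh = (1 / 2 : K) • Dxbc - jxb • Hu - jx • Xib + Bb)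
    (hN5 : N3.op Hu - N4Xib = -((1 / 2 * xbc) • (Hu - H)) - (1 / 2 : K) • XbhHd + Bb) :
    (1 / 2 * div Bc = c4P + 3 / 2 * x * p - dot Hu Bc + XicBb + 1 / 4 * XbhAc)
      ∧ (N3.op Bc = DbP + (3 * p) • Hc - xbc • Bc + BbXhc + (1 / 2 : K) • AcXib)
      ∧ (-((1 / 2 : K) • Dxbc) = -(jxb • Hu) - (1 / 2 : K) • DbXbh - jx • Xib + Bb)
      ∧ (N3.op Hu = -((1 / 2 * xbc) • (Hu - H)) + N4Xib - (1 / 2 : K) • XbhHd + Bb) := by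
  refine ⟨?_, ?_, ?_, ?_⟩
  · linear_combination (-1 : K) * hB1
  · linear_combination (norm := module) hB2c
  · linear_combination (norm := module) hN6
  · linear_combination (norm := module) hN5

/-- First equality of "gives the following": the right-hand side of "Hence," regrouped,
"`RHS = −¼(2conj(tr X̲) + tr X̲)ᶜ𝒟·B̄ + ½H·ᶜ∇₃B̄ + (−½ᶜ𝒟conj(tr X̲) + ᶜ∇₃H̲ − conj(tr X̲)H̲)·B̄
− ᶜ∇₃(Ξ̄·B̲) − ¼ᶜ∇₃(X̲̂·Ā) + ½ᶜ𝒟·(B̲·conj X̂ + ½Ā·Ξ̲) + H̲·(B̲·conj X̂ + ½Ā·Ξ̲) + ½(−B̲̄·B + Ξ̲·∇₄B̄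
− conj(X̲̂)·ᶜ𝒟B̄ − H̄·conj(X̲̂)·B)`" (bilinearity of `·` only).
[cite: GiorgiKlainermanSzeftel2024, p0929 L5–48, p0930 L5–27; GiorgiKlainermanSzeftel2022, l.37600–37609, l.37622–37625] -/
theorem D9_RHS_regroup [CharZero K] {D3 : Derivation ℤ K K} (N3 : CovD D3 M₁)
    (dot : M₁ →ₗ[K] M₁ →ₗ[K] K) (div : M₁ →+ K)
    (xb xbc XicBb XbhAc BbcB XibN4Bc XbhcDBc HcXbhcB : K)
    (Bc Hu H Dxbc BbXhc AcXib : M₁) :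
    -(1 / 2) * xbc * div Bc - 1 / 2 * dot Dxbc Bc
        + 1 / 2 * (-(1 / 2) * xb * div Bc + dot H (N3.op Bc))
        + dot (N3.op Hu) Bc - xbc * dot Hu Bc - D3 XicBb - 1 / 4 * D3 XbhAc
        + 1 / 2 * div (BbXhc + (1 / 2 : K) • AcXib) + dot Hu (BbXhc + (1 / 2 : K) • AcXib)
        + 1 / 2 * (-BbcB + XibN4Bc - XbhcDBc - HcXbhcB)
      = -(1 / 4) * (2 * xbc + xb) * div Bc + 1 / 2 * dot H (N3.op Bc)
        + dot (-((1 / 2 : K) • Dxbc) + N3.op Hu - xbc • Hu) Bc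
        - D3 XicBb - 1 / 4 * D3 XbhAc
        + 1 / 2 * div (BbXhc + (1 / 2 : K) • AcXib) + dot Hu (BbXhc + (1 / 2 : K) • AcXib)
        + 1 / 2 * (-BbcB + XibN4Bc - XbhcDBc - HcXbhcB) := by
  simp only [map_add, map_sub, map_neg, map_smul, LinearMap.add_apply, LinearMap.sub_apply,
    LinearMap.neg_apply, LinearMap.smul_apply, smul_eq_mul]
  ring

/-- Second equality of "gives the following": substituting the four "using" identities (`hu1`–`hu4`,
`D9_using`) and collecting into `Err` (`hErr`, verbatim: "`Err = −ᶜ∇₃(Ξ̄·B̲) − ¼ᶜ∇₃(X̲̂·Ā)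
+ ½ᶜ𝒟·(B̲·conj X̂ + ½Ā·Ξ̲) + H̲·(B̲·conj X̂ + ½Ā·Ξ̲) + ½(−B̲̄·B + Ξ̲·∇₄B̄ − conj(X̲̂)·ᶜ𝒟B̄ − H̄·conj(X̲̂)·B)
− ½(2conj(tr X̲) + tr X̲)(Ξ̄·B̲ + ¼X̲̂·Ā) + ½H·(B̲·conj X̂ + ½Ā·Ξ̲) + (−½conj(ᶜ𝒟)·X̲̂ − iℑ(tr X)Ξ̲ + B̲
+ ᶜ∇₄Ξ̲ − ½X̲̂·(conj H̲ − H̄) + B̲)·B̄`"):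
"`= −½(2conj(tr X̲) + tr X̲)(ᶜ∇₄P + (3/2)tr X P − H̲·B̄) + ½H·(conj(ᶜ𝒟)P + 3PH̄ − conj(tr X̲)B̄)
+ (−iℑ(tr X̲)H̲ − ½conj(tr X̲)(H̲ − H) − conj(tr X̲)H̲)·B̄ + Err`".
[cite: GiorgiKlainermanSzeftel2024, p0930 L5–45 and L63–105; GiorgiKlainermanSzeftel2022, l.37622–37629, l.37632–37639] -/
theorem D9_RHS_subst [CharZero K] {D3 : Derivation ℤ K K} (N3 : CovD D3 M₁)
    (dot : M₁ →ₗ[K] M₁ →ₗ[K] K) (div : M₁ →+ K)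
    (p x xb xbc jxb jx c4P XicBb XbhAc BbcB XibN4Bc XbhcDBc HcXbhcB Err : K)
    (Bc Hu H Hc DbP Dxbc BbXhc AcXib DbXbh Xib Bb N4Xib XbhHd : M₁)
    (hu1 : 1 / 2 * div Bc = c4P + 3 / 2 * x * p - dot Hu Bc + XicBb + 1 / 4 * XbhAc)
    (hu2 : N3.op Bc = DbP + (3 * p) • Hc - xbc • Bc + BbXhc + (1 / 2 : K) • AcXib)
    (hu3 : -((1 / 2 : K) • Dxbc) = -(jxb • Hu) - (1 / 2 : K) • DbXbh - jx • Xib + Bb)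
    (hu4 : N3.op Hu = -((1 / 2 * xbc) • (Hu - H)) + N4Xib - (1 / 2 : K) • XbhHd + Bb)
    (hErr : Err = -D3 XicBb - 1 / 4 * D3 XbhAc
      + 1 / 2 * div (BbXhc + (1 / 2 : K) • AcXib) + dot Hu (BbXhc + (1 / 2 : K) • AcXib)
      + 1 / 2 * (-BbcB + XibN4Bc - XbhcDBc - HcXbhcB)
      - 1 / 2 * (2 * xbc + xb) * (XicBb + 1 / 4 * XbhAc)
      + 1 / 2 * dot H (BbXhc + (1 / 2 : K) • AcXib)
      + dot (-((1 / 2 : K) • DbXbh) - jx • Xib + Bb + N4Xib - (1 / 2 : K) • XbhHd + Bb) Bc) :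
    -(1 / 4) * (2 * xbc + xb) * div Bc + 1 / 2 * dot H (N3.op Bc)
        + dot (-((1 / 2 : K) • Dxbc) + N3.op Hu - xbc • Hu) Bc
        - D3 XicBb - 1 / 4 * D3 XbhAc
        + 1 / 2 * div (BbXhc + (1 / 2 : K) • AcXib) + dot Hu (BbXhc + (1 / 2 : K) • AcXib)
        + 1 / 2 * (-BbcB + XibN4Bc - XbhcDBc - HcXbhcB)
      = -(1 / 2) * (2 * xbc + xb) * (c4P + 3 / 2 * x * p - dot Hu Bc)
        + 1 / 2 * dot H (DbP + (3 * p) • Hc - xbc • Bc)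
        + dot (-(jxb • Hu) - (1 / 2 * xbc) • (Hu - H) - xbc • Hu) Bc + Err := by
  subst hErr
  rw [hu3, hu2, hu4]
  simp only [map_add, map_sub, map_neg, map_smul, LinearMap.add_apply, LinearMap.sub_apply,
    LinearMap.neg_apply, LinearMap.smul_apply, smul_eq_mul]
  linear_combination (-(1 / 2) * (2 * xbc + xb) : K) * hu1

/-- Third equality of "gives the following": the `B̄`-terms cancel,
"`= −½(2conj(tr X̲) + tr X̲)(ᶜ∇₄P + (3/2)tr X P) + ½H·(conj(ᶜ𝒟)P + 3PH̄) + Err`", by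
`tr X̲ − conj(tr X̲) = 2iℑ(tr X̲)` (`hIm`) and the bilinearity of `·`.
[cite: GiorgiKlainermanSzeftel2024, p0930 L29–61; GiorgiKlainermanSzeftel2022, l.37626–37629] -/
theorem D9_RHS_cancel [CharZero K] (dot : M₁ →ₗ[K] M₁ →ₗ[K] K) (p x xb xbc jxb c4P Err : K)
    (Bc Hu H Hc DbP : M₁) (hIm : xb - xbc = 2 * jxb) :
    -(1 / 2) * (2 * xbc + xb) * (c4P + 3 / 2 * x * p - dot Hu Bc)
        + 1 / 2 * dot H (DbP + (3 * p) • Hc - xbc • Bc)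
        + dot (-(jxb • Hu) - (1 / 2 * xbc) • (Hu - H) - xbc • Hu) Bc + Err
      = -(1 / 2) * (2 * xbc + xb) * (c4P + 3 / 2 * x * p) + 1 / 2 * dot H (DbP + (3 * p) • Hc)
        + Err := by
  simp only [map_add, map_sub, map_neg, map_smul, LinearMap.sub_apply, LinearMap.neg_apply,
    LinearMap.smul_apply, smul_eq_mul]
  linear_combination (1 / 2 * dot Hu Bc : K) * hIm

/-! ## §7 "By putting the two together we obtain" -/

/-- The two forms of the same quantity — the `LHS` of `D9_LHS` (`hL`) and the last right-hand side
`−½(2conj(tr X̲) + tr X̲)(ᶜ∇₄P + (3/2)tr X P) + ½H·(conj(ᶜ𝒟)P + 3PH̄) + Err` (`hR`) — give, "where we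
also used `ᶜ∇₃tr X + ½tr X̲ tr X = ᶜ𝒟·H̄ + H·H̄ + 2P + Ξ̲·Ξ̄ − ½X̲̂·conj X̂`" (`hNS`, Proposition
2.4.14): "`ᶜ∇₃ᶜ∇₄P + (3/2)tr X ᶜ∇₃P + ½(2conj(tr X̲) + tr X̲)ᶜ∇₄P − ½ᶜ𝒟·conj(ᶜ𝒟)P − (3/2)H̄·ᶜ𝒟P
− (H̲ + ½H)·conj(ᶜ𝒟)P + (3/2)[conj(tr X̲)tr X + 2P − 2H̲·H̄]P = Err − (3/2)(Ξ̲·Ξ̄ − ½X̲̂·conj X̂)P`".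
[cite: GiorgiKlainermanSzeftel2024, p0930 L107–140, Proposition 2.4.14 p0117 L61–66; GiorgiKlainermanSzeftel2022, l.37640–37650, l.5234] -/
theorem D9_together [CharZero K] (D3 : Derivation ℤ K K) (dot : M₁ →ₗ[K] M₁ →ₗ[K] K) (div : M₁ →+ K)
    (T p x xb xbc c4P XibXic XbhXhc Err : K) (Hu H Hc DP DbP : M₁)
    (hL : T = D3 c4P + 3 / 2 * x * D3 p - 1 / 2 * div DbP - 3 / 2 * dot Hc DP - dot Hu DbP
        + 3 / 2 * (-div Hc + D3 x - 2 * dot Hu Hc) * p)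
    (hR : T = -(1 / 2) * (2 * xbc + xb) * (c4P + 3 / 2 * x * p) + 1 / 2 * dot H (DbP + (3 * p) • Hc)
        + Err)
    (hNS : D3 x + 1 / 2 * xb * x = div Hc + dot H Hc + 2 * p + XibXic - 1 / 2 * XbhXhc) :
    D3 c4P + 3 / 2 * x * D3 p + 1 / 2 * (2 * xbc + xb) * c4P - 1 / 2 * div DbP
        - 3 / 2 * dot Hc DP - dot (Hu + (1 / 2 : K) • H) DbP
        + 3 / 2 * (xbc * x + 2 * p - 2 * dot Hu Hc) * p
      = Err - 3 / 2 * (XibXic - 1 / 2 * XbhXhc) * p := by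
  simp only [map_add, map_smul, LinearMap.add_apply, LinearMap.smul_apply, smul_eq_mul] at hR ⊢
  linear_combination hR - hL - (3 / 2 * p : K) * hNS

/-! ## §8 The wave operator of a scalar of conformal type `0` -/

/-- "From Lemma 4.7.4, we deduce `□_g P = −e₃(e₄(P)) + (2ω̲ − ½tr χ̲)∇₄P − ½tr χ ∇₃P + 2η·∇P + ΔP`":
from Lemma 4.7.4 for the scalar `P`, "`□̇₀ψ = −½(∇₃∇₄ψ + ∇₄∇₃ψ) + (ω̲ − ½tr χ̲)∇₄ψ + (ω − ½tr χ)∇₃ψ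
+ Δ₀ψ + (η + η̲)·∇ψ`" (`h474`), and the frame commutator (2.2.15), "`[∇₄, ∇₃]f = 2(η̲ − η)·∇f
+ 2ω∇₃f − 2ω̲∇₄f`" for `f = P` (`h2215`; `e4e3P = ∇₄∇₃P`, `e3e4P = ∇₃∇₄P = e₃(e₄(P))`).
[cite: GiorgiKlainermanSzeftel2024, p0931 L5–12, Lemma 4.7.4 p0180 L24–39, (2.2.15) p0096 L25–40; GiorgiKlainermanSzeftel2022, l.37653–37656, l.8128–8138, l.4227–4233] -/
theorem D9_box_frame [CharZero K] (dot : M₁ →ₗ[K] M₁ →ₗ[K] K)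
    (trch trchb om omb e3P e4P e3e4P e4e3P LapP boxP : K) (eta etab gradP : M₁)
    (h474 : boxP = -(1 / 2) * (e3e4P + e4e3P) + (omb - 1 / 2 * trchb) * e4P
      + (om - 1 / 2 * trch) * e3P + LapP + dot (eta + etab) gradP)
    (h2215 : e4e3P - e3e4P = 2 * dot (etab - eta) gradP + 2 * om * e3P - 2 * omb * e4P) :
    boxP = -e3e4P + (2 * omb - 1 / 2 * trchb) * e4P - 1 / 2 * trch * e3P + 2 * dot eta gradP
      + LapP := by
  simp only [map_add, map_sub, LinearMap.add_apply, LinearMap.sub_apply] at h474 h2215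
  linear_combination h474 - (1 / 2 : K) * h2215

/-- "We therefore deduce for `P` of conformal type 0: `□_g P = −ᶜ∇₃ᶜ∇₄P + ½ᶜ𝒟·conj(ᶜ𝒟)P − ½tr X̲ ᶜ∇₄P
− ½tr X ᶜ∇₃P + ½H̄·ᶜ𝒟P + ½H·conj(ᶜ𝒟)P`": from the frame form (`hframe`, `D9_box_frame`), the two
displays "Also, we have `½𝒟·conj(𝒟)P = … = ΔP − (i/2)(ªtr χ e₃P + ªtr χ̲ e₄P)`" (`hDDb`) and
"`H̄·𝒟P + H·conj(𝒟)P = … = 4η·∇P`" (`hHD`), Definition 2.4.8 "`tr X = tr χ − iªtr χ`, `tr X̲ = tr χ̲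
− iªtr χ̲`" (`hX`, `hXb`) and Lemma 2.2.17 / Definition 2.4.13 for the type-`0` scalar `P`: `ᶜ∇₃P = e₃P`,
`ᶜ∇₄P = e₄P`, `ᶜ𝒟P = 𝒟P`, `conj(ᶜ𝒟)P = conj(𝒟)P`, `ᶜ𝒟·conj(ᶜ𝒟)P = 𝒟·conj(𝒟)P` (same symbols), and,
`ᶜ∇₄P` having signature `1`, `ᶜ∇₃ᶜ∇₄P = e₃(e₄P) − 2ω̲e₄P` (`h3`, `h4`, `h34`).
[cite: GiorgiKlainermanSzeftel2024, p0931 L13–52, Lemma 2.2.17 p0105 L7–10, Definition 2.4.8 p0113 L44–48, Definition 2.4.13 p0116 L89 – p0117 L40; GiorgiKlainermanSzeftel2022, l.37657–37673, l.4559–4568, l.5052–5054, l.5191–5214] -/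
theorem D9_box_type0 [CharZero K] (dot : M₁ →ₗ[K] M₁ →ₗ[K] K) (div : M₁ →+ K)
    (i trch atrch trchb atrchb omb x xb e3P e4P e3e4P LapP boxP c3P c4P c3c4P : K)
    (eta gradP Hc H DP DbP : M₁)
    (hframe : boxP = -e3e4P + (2 * omb - 1 / 2 * trchb) * e4P - 1 / 2 * trch * e3P
      + 2 * dot eta gradP + LapP)
    (hDDb : 1 / 2 * div DbP = LapP - i / 2 * (atrch * e3P + atrchb * e4P))
    (hHD : dot Hc DP + dot H DbP = 4 * dot eta gradP)
    (hX : x = trch - i * atrch) (hXb : xb = trchb - i * atrchb)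
    (h3 : c3P = e3P) (h4 : c4P = e4P) (h34 : c3c4P = e3e4P - 2 * omb * e4P) :
    boxP = -c3c4P + 1 / 2 * div DbP - 1 / 2 * xb * c4P - 1 / 2 * x * c3P + 1 / 2 * dot Hc DP
      + 1 / 2 * dot H DbP := by
  subst hX hXb h3 h4 h34
  linear_combination hframe - hDDb - (1 / 2 : K) * hHD

/-! ## §9 "We then obtain from the above computations": Lemma 5.5.1 -/

/-- KERNEL FORM of the last step.  From "putting the two together" (`htog`, `D9_together`) and the
type-`0` form of `□_g P` (`hbox`, `D9_box_type0` with `ᶜ∇₃ᶜ∇₄P = D3 c4P`, `ᶜ∇₃P = D3 p`): the principal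
terms of (5.5.1) exactly as printed, "`□_g P = tr X ᶜ∇₃P + conj(tr X̲) ᶜ∇₄P − H̄·ᶜ𝒟P − H̲·conj(ᶜ𝒟)P
+ (3/2)[conj(tr X̲)tr X + 2P − 2H̲·H̄]P + Err[□_g P]`", with the remainder the kernel finds in the place
of `Err[□_g P]`: `−Err + (3/2)(Ξ̲·Ξ̄ − ½X̲̂·conj X̂)P`.  The text prints `Err[□_g P] = Err − (3/2)(Ξ̲·Ξ̄
− ½X̲̂·conj X̂)P` (p0931 L60–68, (5.5.2)): see `D9_err_datum` and the module docstring (PD-sign).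
[cite: GiorgiKlainermanSzeftel2024, p0931 L54–70, Lemma 5.5.1 p0205 L5–72; GiorgiKlainermanSzeftel2022, l.37675–37685, l.9335–9360] -/
theorem D9_lemma551 [CharZero K] (D3 : Derivation ℤ K K) (dot : M₁ →ₗ[K] M₁ →ₗ[K] K) (div : M₁ →+ K)
    (p x xb xbc c4P XibXic XbhXhc Err boxP : K) (Hu H Hc DP DbP : M₁)
    (htog : D3 c4P + 3 / 2 * x * D3 p + 1 / 2 * (2 * xbc + xb) * c4P - 1 / 2 * div DbP
        - 3 / 2 * dot Hc DP - dot (Hu + (1 / 2 : K) • H) DbP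
        + 3 / 2 * (xbc * x + 2 * p - 2 * dot Hu Hc) * p
      = Err - 3 / 2 * (XibXic - 1 / 2 * XbhXhc) * p)
    (hbox : boxP = -D3 c4P + 1 / 2 * div DbP - 1 / 2 * xb * c4P - 1 / 2 * x * D3 p
      + 1 / 2 * dot Hc DP + 1 / 2 * dot H DbP) :
    boxP = x * D3 p + xbc * c4P - dot Hc DP - dot Hu DbP
      + 3 / 2 * (xbc * x + 2 * p - 2 * dot Hu Hc) * p
      + (-Err + 3 / 2 * (XibXic - 1 / 2 * XbhXhc) * p) := by
  simp only [map_add, map_smul, LinearMap.add_apply, LinearMap.smul_apply, smul_eq_mul] at htog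
  linear_combination hbox - htog

/-- THE PRINT DATUM (PD-sign), isolated.  With `Err[□_g P]` as PRINTED, "`Err[□_g P] = Err − (3/2)(Ξ̲·Ξ̄
− ½X̲̂·conj X̂)P`" (`hEB`, p0931 L60–68 = (5.5.2)), the kernel's Lemma 5.5.1 (`h551`, `D9_lemma551`)
reads `□_g P = tr X ᶜ∇₃P + conj(tr X̲)ᶜ∇₄P − H̄·ᶜ𝒟P − H̲·conj(ᶜ𝒟)P + (3/2)[conj(tr X̲)tr X + 2P −
2H̲·H̄]P − Err[□_g P]`, where (5.5.1) prints `+ Err[□_g P]`.  Offered to the census, not a ruling; the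
downstream use ((14.2.1), Remark 5.5.2) is schematic.
[cite: GiorgiKlainermanSzeftel2024, (5.5.1)–(5.5.2) p0205 L5–72, p0931 L54–68; GiorgiKlainermanSzeftel2022, l.9339–9356, l.37675–37685] -/
theorem D9_err_datum (D3 : Derivation ℤ K K) (dot : M₁ →ₗ[K] M₁ →ₗ[K] K)
    (p x xbc c4P XibXic XbhXhc Err ErrBox boxP : K) (Hu Hc DP DbP : M₁)
    (h551 : boxP = x * D3 p + xbc * c4P - dot Hc DP - dot Hu DbP
      + 3 / 2 * (xbc * x + 2 * p - 2 * dot Hu Hc) * p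
      + (-Err + 3 / 2 * (XibXic - 1 / 2 * XbhXhc) * p))
    (hEB : ErrBox = Err - 3 / 2 * (XibXic - 1 / 2 * XbhXhc) * p) :
    boxP = x * D3 p + xbc * c4P - dot Hc DP - dot Hu DbP
      + 3 / 2 * (xbc * x + 2 * p - 2 * dot Hu Hc) * p - ErrBox := by
  linear_combination h551 + hEB

/-- Lemma 5.5.1, END TO END, in ONE theorem from the primitive quoted hypotheses of App. D.9: the two
Bianchi identities (`hB1`, `hB2c`), the definition of the commutator (`hcomm`) and its quoted value
(`hcommF` with `hs : s = 1`), the three product-rule instances the text expands (`hd3HB`, `hdivxB`,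
`hdivpH`), the three null structure equations (`hN6`, `hN5`, `hNS`), `tr X̲ − conj(tr X̲) = 2iℑ(tr X̲)`
(`hIm`), the definition of `Err` (`hErr`), Lemma 4.7.4 (`h474`), (2.2.15) (`h2215`), the two "Also, we
have" displays (`hDDb`, `hHD`), Definition 2.4.8 (`hX`, `hXb`) and the type-`0` dictionary (`h3`, `h4`,
`h34`).  No intermediate display is re-entered.  Conclusion = the kernel form of `D9_lemma551`.
[cite: GiorgiKlainermanSzeftel2024, Lemma 5.5.1 p0205 L5–72, App. D.9 p0927 L62 – p0931 L70, Proposition 2.4.14 p0117 L43 – p0118 L31, Proposition 2.4.15 p0118 L33–100, Lemma 2.2.17 p0105 L7–10, (2.2.15) p0096 L25–40, Definition 2.4.8 p0113 L29–48, Lemma 4.7.4 p0180 L24–39; GiorgiKlainermanSzeftel2022, l.9335–9360, l.37551–37686, l.5226–5270, l.4559–4568, l.4220–4235, l.5041–5055, l.8128–8138] -/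
theorem D9_lemma551_end_to_end [CharZero K] {D3 : Derivation ℤ K K} (N3 : CovD D3 M₁)
    (dot : M₁ →ₗ[K] M₁ →ₗ[K] K) (div : M₁ →+ K)
    (p x xb xbc jxb jx c4P comm s XicBb XbhAc BbcB XibN4Bc XbhcDBc HcXbhcB XibXic XbhXhc Err boxP
      i trch atrch trchb atrchb om omb e3P e4P e3e4P e4e3P LapP : K)
    (Bc Hu H Hc DP DbP Dxbc BbXhc AcXib DbXbh Xib Bb N4Xib XbhHd eta etab gradP : M₁)
    (hB1 : c4P - 1 / 2 * div Bc = -(3 / 2) * x * p + dot Hu Bc - XicBb - 1 / 4 * XbhAc)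
    (hB2c : N3.op Bc - DbP = -(xbc • Bc) + (3 * p) • Hc + BbXhc + (1 / 2 : K) • AcXib)
    (hcomm : comm = D3 (div Bc) - div (N3.op Bc))
    (hcommF : comm = -(1 / 2) * xb * (div Bc + (s - 1) * dot H Bc) + dot H (N3.op Bc)
      - BbcB + XibN4Bc - XbhcDBc - HcXbhcB)
    (hs : s = 1)
    (hd3HB : D3 (dot Hu Bc) = dot (N3.op Hu) Bc + dot Hu (N3.op Bc))
    (hdivxB : div (xbc • Bc) = xbc * div Bc + dot Dxbc Bc)
    (hdivpH : div ((3 * p) • Hc) = 3 * p * div Hc + 3 * dot Hc DP)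
    (hN6 : (1 / 2 : K) • DbXbh = (1 / 2 : K) • Dxbc - jxb • Hu - jx • Xib + Bb)
    (hN5 : N3.op Hu - N4Xib = -((1 / 2 * xbc) • (Hu - H)) - (1 / 2 : K) • XbhHd + Bb)
    (hNS : D3 x + 1 / 2 * xb * x = div Hc + dot H Hc + 2 * p + XibXic - 1 / 2 * XbhXhc)
    (hIm : xb - xbc = 2 * jxb)
    (hErr : Err = -D3 XicBb - 1 / 4 * D3 XbhAc
      + 1 / 2 * div (BbXhc + (1 / 2 : K) • AcXib) + dot Hu (BbXhc + (1 / 2 : K) • AcXib)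
      + 1 / 2 * (-BbcB + XibN4Bc - XbhcDBc - HcXbhcB)
      - 1 / 2 * (2 * xbc + xb) * (XicBb + 1 / 4 * XbhAc)
      + 1 / 2 * dot H (BbXhc + (1 / 2 : K) • AcXib)
      + dot (-((1 / 2 : K) • DbXbh) - jx • Xib + Bb + N4Xib - (1 / 2 : K) • XbhHd + Bb) Bc)
    (h474 : boxP = -(1 / 2) * (e3e4P + e4e3P) + (omb - 1 / 2 * trchb) * e4P
      + (om - 1 / 2 * trch) * e3P + LapP + dot (eta + etab) gradP)
    (h2215 : e4e3P - e3e4P = 2 * dot (etab - eta) gradP + 2 * om * e3P - 2 * omb * e4P)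
    (hDDb : 1 / 2 * div DbP = LapP - i / 2 * (atrch * e3P + atrchb * e4P))
    (hHD : dot Hc DP + dot H DbP = 4 * dot eta gradP)
    (hX : x = trch - i * atrch) (hXb : xb = trchb - i * atrchb)
    (h3 : D3 p = e3P) (h4 : c4P = e4P) (h34 : D3 c4P = e3e4P - 2 * omb * e4P) :
    boxP = x * D3 p + xbc * c4P - dot Hc DP - dot Hu DbP
      + 3 / 2 * (xbc * x + 2 * p - 2 * dot Hu Hc) * p
      + (-Err + 3 / 2 * (XibXic - 1 / 2 * XbhXhc) * p) := by
  -- §1–§4: the left-hand side equals the right-hand side of "Hence,"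
  have e1 := D9_differentiate N3 dot div p x c4P comm XicBb XbhAc Bc Hu hB1 hcomm hd3HB
  have e2 := D9_deduce N3 dot div p x xbc c4P comm XicBb XbhAc Bc Hu Hc DbP BbXhc AcXib e1 hB2c
  have e3 := D9_hence1 N3 dot div p x xbc c4P comm XicBb XbhAc Bc Hu Hc DbP BbXhc AcXib e2
  have eC := D9_commutator_B N3 dot div s xb comm BbcB XibN4Bc XbhcDBc HcXbhcB Bc H hcommF hs
  have e4 := D9_hence2 N3 dot div p x xb xbc c4P comm XicBb XbhAc BbcB XibN4Bc XbhcDBc HcXbhcB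
    Bc Hu H Hc DbP Dxbc BbXhc AcXib e3 eC hdivxB
  -- §5: the LHS form
  have e5 := D9_LHS D3 dot div p x c4P Hu Hc DP DbP hdivpH
  -- §6: the RHS chain
  obtain ⟨u1, u2, u3, u4⟩ := D9_using N3 dot div p x xbc c4P XicBb XbhAc jxb jx Bc Hu H Hc DbP Dxbc
    BbXhc AcXib DbXbh Xib Bb N4Xib XbhHd hB1 hB2c hN6 hN5
  have e6 := D9_RHS_regroup N3 dot div xb xbc XicBb XbhAc BbcB XibN4Bc XbhcDBc HcXbhcB
    Bc Hu H Dxbc BbXhc AcXib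
  have e7 := D9_RHS_subst N3 dot div p x xb xbc jxb jx c4P XicBb XbhAc BbcB XibN4Bc XbhcDBc HcXbhcB
    Err Bc Hu H Hc DbP Dxbc BbXhc AcXib DbXbh Xib Bb N4Xib XbhHd u1 u2 u3 u4 hErr
  have e8 := D9_RHS_cancel dot p x xb xbc jxb c4P Err Bc Hu H Hc DbP hIm
  -- §7
  have e9 := D9_together D3 dot div _ p x xb xbc c4P XibXic XbhXhc Err Hu H Hc DP DbP e5
    (e4.trans (e6.trans (e7.trans e8))) hNS
  -- §8
  have eF := D9_box_frame dot trch trchb om omb e3P e4P e3e4P e4e3P LapP boxP eta etab gradP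
    h474 h2215
  have eB := D9_box_type0 dot div i trch atrch trchb atrchb omb x xb e3P e4P e3e4P LapP boxP
    (D3 p) c4P (D3 c4P) eta gradP Hc H DP DbP eF hDDb hHD hX hXb h3 h4 h34
  -- §9
  exact D9_lemma551 D3 dot div p x xb xbc c4P XibXic XbhXhc Err boxP Hu H Hc DP DbP e9 eB

end AppD9

end Literature.Geometry.Lorentzian.GiorgiKlainermanSzeftel2022.PWaveEquationLedger
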